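import Summits.QuantumFields.YangMills.Theses.FradkinShenkerFlow
import Summits.QuantumFields.YangMills.Theorems.SusceptibilityToPoincare.Negative.Bottleneck
import Summits.QuantumFields.YangMills.Theorems.FradkinShenkerFlowSusceptibilityToPoincareTwoBlockFactorization
import Summits.QuantumFields.YangMills.Theorems.FradkinShenkerFlowSusceptibilityToPoincareBoxDecouplingOfHMC
import Summits.QuantumFields.YangMills.Theorems.FradkinShenkerFlowSusceptibilityToPoincareLocalPoincareSmallCylinders
import Summits.QuantumFields.YangMills.Theorems.FradkinShenkerFlowSusceptibilityToPoincareBisection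

/-!
# Line `maxcorr-halving` — checked skeleton for crux stmt-QuantumFields-9441
(`Summit.QuantumFields.YangMills.Theses.FradkinShenkerFlow.SusceptibilityToPoincare`, FS(β) ⇒ UP(β))

Planner `planner-cruxplan-stmt-QuantumFields-9441-maxcorr-halving-0`, 2026-08-16 (crux-plan, round 1; idea card
`Cruxes/SusceptibilityToPoincare/Ideas/maxcorr-halving.md`, triage TRIAGE-r1-2 (m1–m4) / TRIAGE-r1-3 (a),(b) absorbed).
LEAD: `prover-line-stmt-QuantumFields-9441-0` (opening lead gen 1, PICKED 2026-08-16): skeleton owned verbatim at registration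
(wave 1: C1–C4 delegated, A2 held by the lead, A1 unstaffed, A3 sentinel); reshapes of this file are re-registered and re-published here.
Stub status (wave 1 integrated 2026-08-16): C1 LANDED p77169 · C2 LANDED p81511 (+ Literature helper TorusWilsonMarkov p78780) ·
C3 LANDED p85508 (+ p78986) · C4 LANDED p81397 (+ p78559, p80186) — hence `up_of_hmc_of` is a THEOREM (HMC ⇒ UP for every compact G, real β);
A1 open (unstaffed) · A2 open (lead) · A3 sentinel.  Sorries: exactly A1, A2, A3.
PARTIAL COMPOSITION LANDED p93116 (`Theorems/FradkinShenkerFlowSusceptibilityToPoincareUpOfHMC.lean`): `up_of_hmc` (HMC ⇒ UP, every compact G,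
real β) and `susceptibilityToPoincare_of_hmc_of_fs` ((∀ simple G, r, β ≥ 0, FS → HMC) → crux) are TREE THEOREMS.
A1 falsifier (kit j015620, SU(2) slab with frozen wall flux, β_std 2.3–2.7): no film coexistence — A1 survives its cheapest kill.
CAVEAT ON A2 AS TYPED (lead, 2026-08-16T11Z, from drefute p77766 `Negative/TwistSectorSimplyConnected.lean` + kit j011508): the SU(2)
mixed-action witness (r = ρ_{1/2} ⊕ ρ₁^{⊕k}, small β, "phase II") carries exactly conserved, slab-readable ℤ₂ twist classes, so (T) fails there
(shared bit between a time slab and its far set, ρ = 1) while FS is expected: A2 — like the crux and orbit-slice 4a — is FALSE MODULO the same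
open inputs even for π₁(G) = 0; the honest re-typing is `∃ β₁(G,r), ∀ β ≥ β₁` (or `r` irreducible / centre-faithful part not weakly coupled).
C1–C4, `up_of_hmc` and A1's shape are untouched by any re-typing (they hold for every compact G and real β).

Crux (route FradkinShenkerFlow, rank 2): for every compact simple Lie group `G`, faithful unitary lattice representation
`r`, `β ≥ 0`: finite gauge-invariant susceptibility of the torus Wilson measures uniformly in the side `2S+1` (FS) ⟹ a
UNIFORM single-link heat-bath Poincaré inequality `Var_μ F ≤ C Σ_ℓ ∫∫ (F U − F(U[ℓ ↦ g]))² dν_ℓ^U dμ` for all bounded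
measurable `F` (UP).

## The line: ONE-SCALE SLAB DECORRELATION ⟹ UP by L²-bisection; FS ⟹ decorrelation is the infrared content

Objects. For a set `D` of links, `𝓕_D := cylinderEvents D` (σ-algebra of the link variables in `D`) and
`P_D := E_μ[ · | 𝓕_D]` (Mathlib `condExp`). A CYLINDER of the torus `(ℤ/(2S+1))⁴` is `Q(a,n) = {x | ∀ ν, (x_ν − a_ν).val < n_ν}`
(`n_ν ≤ 2S+1`; `n_ν = 2S+1` = full ring, `n_ν ≤ 2S` = an interval side), its EXTERIOR is `K = {ℓ | ℓ.1 ∉ Q}` (links based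
outside `Q`), an `R`-SLAB of `Q` in direction `i` at offset `c` is `{ℓ | ℓ.1 ∈ Q, (ℓ.1 i − a_i − c).val < R}` and its FAR SET
is `{ℓ | ℓ.1 ∈ Q, 3R ≤ (ℓ.1 i − a_i − c + R).val}` (the links of `Q` at torus-distance `≥ R` from the slab on either side).
The CONDITIONAL MAXIMAL CORRELATION bound `ρ(X, Z | K) ≤ ρ` is the operator inequality
`‖P_{K∪X} P_{K∪Z} f − P_K f‖₂ ≤ ρ ‖f − P_K f‖₂` for all bounded measurable `f` (fibrewise in the exterior = for ALL boundary
data, TRIAGE-r1-3 (b); no regular conditional probabilities are needed anywhere: every statement is an integrated L²(μ) inequality).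

  (T)  `TorusDecorrelation r β`  — ∃ R ≥ 1, ρ < 1: on every torus, for every direction and position, the slab/far-set
       bound `‖P_slab P_far f − E f‖₂ ≤ ρ ‖f − E f‖₂` (no exterior: `K = ∅`).  By reflection positivity this is, for time
       slabs, a UNIFORM-in-`S` transfer-matrix gap at ONE scale (`ρ ≈ e^{−m_S R}`): the static one-scale form of clustering.
  (H)  `HMC r β` (re-typed as the recursion consumes it, TRIAGE-r1-2 (m2)/(m1), r1-3 (b)): the same bound for the slabs of
       EVERY cylinder `Q`, conditionally on its exterior (all boundary data), far set inside `Q`.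
  (B)  `BoxDecoupling r β`: (ring) two antipodal `R`-slabs of a ring direction of `Q` have `ρ ≤ ρ₀ < 1` given the exterior;
       (corridor) the two sides of a corridor of `m` consecutive `R`-slabs in an interval direction have `ρ ≤ ρ₀^{⌊m/2⌋}`.

Stubs (seven, registered; sizes are guesses):
  C1 `stub_twoBlockFactorization`    [M, provable now] the SHARP Hilbert-angle inequality (card's first lemma in the iterable
      form of TRIAGE-r1-2 `sharp_angle_ineq`): `K ⊆ D₁ ∩ D₂`, `‖P_{D₁}P_{D₂} − P_K‖ ≤ ρ < 1` ⟹
      `E(F − P_K F)² ≤ (1−ρ)⁻² (E(F − P_{D₁}F)² + E(F − P_{D₂}F)²)` — constant → 1 as ρ → 0, so it iterates.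
  C2 `stub_boxDecoupling_of_hmc`     [M+, provable now] (H) ⟹ (B): Markov property of the Wilson measure across a separating
      slab in operator form `P_X P_Z = P_X P_Y P_Z`, the exact telescoping `P_X P_Z − P_K = (P_X P_Y − P_K)(P_Y P_Z − P_K)`
      (TRIAGE-r1-3: submultiplicativity TRUE in operator form), monotonicity in `X, Z`, slab counting.
  C3 `stub_localPoincare_smallCylinders` [M+, provable now] per-volume Poincaré for small cylinders, uniformly in `S` and in
      the exterior (Holley–Stroock w.r.t. product Haar on `≤ 4m⁴` links + Efron–Stein + Haar→heat-bath comparison,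
      constant `e^{O(β N m⁴)}`; Disproof §4 "per-S Poincaré is true"; landed HaarResample lemmas p74627 reusable).
  C4 `stub_bisection`                [L, provable now] Martinelli's bisection in max-corr currency (TRIAGE-r1-2 (m1), r1-3 (a)):
      C1-statement → (B) → C3-statement → UP: open the four rings (factor ≤ 2(1−ρ₀)⁻² each), then cut the longest interval
      side across a corridor of width `w_k ≍ √l_k` averaged over `≍ √l_k` disjoint positions (absorbs the double-counted
      Dirichlet form: factor `1 + O(l_k^{-1/2})`), `Π_k (1 − ρ₀^{w_k/2R})⁻²(1 + c l_k^{-1/2}) < ∞`; base = C3.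
  A1 `stub_hmc_of_torusDecorrelation` [L–XL, plausible] FS ∧ (T) ⟹ (H): bulk one-scale decorrelation is robust under
      freezing an exterior (no boundary-induced shared bit). Risk = TRIAGE-r1-2 (m2): an exterior tuned to a first-order
      FILM transition on a face (wall-induced phase coexistence along the boundary layer) would give ρ → 1 with (T) intact.
  A2 `stub_torusDecorrelation_of_fs` [XL, OPEN — the hardest stub] simple `G`, `π₁(G) = 0`, `β ≥ 0`: FS ⟹ (T).  This IS the
      crux's infrared (and d = 4) content in its weakest static form: "finite susceptibility ⟹ no slab statistic is
      reconstructible from distance ≥ R, uniformly in the volume" (sharpness for gauge theories; its d = 5 twin is false in a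
      non-abelian Coulomb phase, TRIAGE S1, so any proof is genuinely four-dimensional).
  A3 `stub_torusDecorrelation_of_fs_nonSimplyConnected` [SCOPE SENTINEL, suspected FALSE, not to be staffed] the same for
      `π₁(G) ≠ 0` (SO(3), PSU(N)…): the 't Hooft twist through a coordinate plane is readable inside a slab AND inside its far
      set ⟹ ρ = 1 at weak coupling.  Registered only because the crux quantifies over all compact simple `G`; a refutation BY
      NAME re-scopes the crux to `SimplyConnectedSpace G` (planner) and leaves C1–C4, A1, A2 verbatim.
Composition (sorry-free, §3): A2/A3 by cases on `π₁(G) = 0` give (T); A1 gives (H); C2 gives (B); C4 fed with C1 and C3 gives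
UP; `SusceptibilityToPoincare_of` is the crux BY NAME.

Disproof.lean (cdisprove v1, `Cruxes/SusceptibilityToPoincare/Disproof.lean`, read 2026-08-16T02:10Z) — honoured:
  * §1 bottleneck lemma (landed: `Theorems/SusceptibilityToPoincare/Negative/Bottleneck.lean`, imported here,
    `not_uniformHeatBathPoincare_of_bottleneck`): a slow event of mass in [δ,1−δ] with vanishing heat-bath flux kills UP.  In
    this line such an event is a SHARED BIT between a slab and its far set (ρ = 1): it can only enter through (T), i.e. through
    A2/A3 — C1–C4 and A1 are consistent with every bottleneck (they assert no decorrelation by themselves).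
  * §2 `susceptibilityToPoincare_false_of_twistSectorInputs` (¬crux MODULO H = TwistSectorInputs): the witness (SO(3) twist
    sectors) violates (T) exactly; FS is used ONLY in A1/A2/A3 and `π₁ = 0` exactly in A2 — the line "uses H at A2": for
    `π₁(G) = 0` no twist label exists, which is what A2's proof must exploit; A3 is killed modulo the same H (via A1, C1–C4).
  * §3 targets the orbit-slice sentinel only; §4 (per-S Poincaré true, content = uniformity in S) is C3 + C4's bookkeeping;
    "0 ≤ β possibly unnecessary": C1–C4 hold for every real β; 0 ≤ β is kept as a (possibly idle) hypothesis of A1–A3.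
  * No `_false_without_` theorem exists; the only landed Negative lemma (Bottleneck) refutes no stub instance (it is a tool).
Sorries: exactly the seven `stub_*`.  Registered signatures are spelled over tree/Mathlib declarations only (`condExp`,
`cylinderEvents`, `wilsonMeasure`, `wilsonAction`, `haarProbability`, `Measure.tilted`, `ZMod.val`, `Set.indicator`), with the
measure and the regions introduced by `∀ x, x = … →` binders (no `:=` inside a signature); the §0 vocabulary is used only in the
sorry-free composition and unfolds to the stub statements definitionally.
-/

namespace Summit.QuantumFields.YangMills.Cruxes.SusceptibilityToPoincare.MaxcorrHalving

open MeasureTheory ProbabilityTheory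
open Literature.MathematicalPhysics.QuantumFieldTheory

noncomputable section

/-! ### §0 Vocabulary (transparent names for VERBATIM sub-formulas; used only in the sorry-free composition) -/

section Vocabulary

variable {G : Type} [Group G] [TopologicalSpace G] [IsTopologicalGroup G] [CompactSpace G]
  [MeasurableSpace G] [BorelSpace G]

/-- FS(r, β): finite gauge-invariant susceptibility uniformly in the volume — verbatim the crux hypothesis. -/
def FS (r : LatticeRep G) (β : ℝ) : Prop :=
  ∀ A B : YMSpecies G, ∃ χ : ℝ, ∀ S : ℕ, ∑ x ∈ Literature.Probability.LatticeModels.box 4 S,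
    |covariance (fun U => A.F (Literature.MathematicalPhysics.QuantumLattice.torusLift (2 * S + 1) U))
      (fun U => B.F (Literature.MathematicalPhysics.QuantumLattice.configShift (-x)
          (Literature.MathematicalPhysics.QuantumLattice.torusLift (2 * S + 1) U)))
      (wilsonMeasure (d := 4) (L := 2 * S + 1) r.ρ β)| ≤ χ

/-- UP(r, β): the uniform single-link heat-bath Poincaré inequality for ALL bounded measurable `F` — verbatim the
crux conclusion. -/
def UP (r : LatticeRep G) (β : ℝ) : Prop :=
  ∃ C : ℝ, ∀ S : ℕ, ∀ F : GaugeConfig 4 (2 * S + 1) G → ℝ, Measurable F → (∃ M : ℝ, ∀ U, |F U| ≤ M) →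
    variance F (wilsonMeasure (d := 4) (L := 2 * S + 1) r.ρ β) ≤
      C * ∑ ℓ : Edge 4 (2 * S + 1), ∫ U, ∫ g, (F U - F (Function.update U ℓ g)) ^ 2
        ∂((haarProbability G).tilted (fun g' => -β * wilsonAction r.ρ (Function.update U ℓ g')))
        ∂(wilsonMeasure (d := 4) (L := 2 * S + 1) r.ρ β)

/-- (T) `TorusDecorrelation r β` — ONE-SCALE SLAB DECORRELATION ON THE TORUS: there are a thickness `R ≥ 1` and `ρ < 1` such
that on every torus `(ℤ/(2S+1))⁴`, for every direction `i` and position `b`, every bounded measurable `f`: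
`‖E[E[f | links beyond distance R from the slab] | links of the slab [b, b+R)] − E f‖₂ ≤ ρ ‖f − E f‖₂` in `L²(μ_{β,S})`
(maximal correlation between an `R`-slab and its far set at most `ρ`, uniformly in the volume). -/
def TorusDecorrelation (r : LatticeRep G) (β : ℝ) : Prop :=
  ∃ R : ℕ, 1 ≤ R ∧ ∃ ρ : ℝ, 0 ≤ ρ ∧ ρ < 1 ∧ ∀ (S : ℕ) (μW : Measure (GaugeConfig 4 (2 * S + 1) G)),
    μW = (wilsonMeasure r.ρ β : Measure (GaugeConfig 4 (2 * S + 1) G)) →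
    ∀ (i : Fin 4) (b : ZMod (2 * S + 1)),
    ∀ f : GaugeConfig 4 (2 * S + 1) G → ℝ, Measurable f → (∃ M : ℝ, ∀ U, |f U| ≤ M) →
    ∫ U, (condExp (cylinderEvents {ℓ : Edge 4 (2 * S + 1) | (ℓ.1 i - b).val < R}) μW
        (condExp (cylinderEvents {ℓ : Edge 4 (2 * S + 1) | 3 * R ≤ (ℓ.1 i - b + (R : ZMod (2 * S + 1))).val}) μW f) U
        - ∫ V, f V ∂μW) ^ 2 ∂μW ≤
      ρ ^ 2 * ∫ U, (f U - ∫ V, f V ∂μW) ^ 2 ∂μW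

/-- (H) `HMC r β` — the HIERARCHICAL MAXIMAL-CORRELATION HYPOTHESIS, typed as the bisection consumes it: there are `R ≥ 1`
and `ρ < 1` such that for every torus, every cylinder `Q = Q(a,n)` with exterior `K = {ℓ | ℓ.1 ∉ Q}`, every direction `i`
and offset `c` (the slab inside `Q` when the side is an interval), and every bounded measurable `f`:
`‖P_{K ∪ slab} P_{K ∪ far} f − P_K f‖₂ ≤ ρ ‖f − P_K f‖₂` — conditionally on ALL boundary data (fibrewise), the `R`-slab
of `Q` at offset `c` and the links of `Q` at distance `≥ R` from it have maximal correlation `≤ ρ`. -/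
def HMC (r : LatticeRep G) (β : ℝ) : Prop :=
  ∃ R : ℕ, 1 ≤ R ∧ ∃ ρ : ℝ, 0 ≤ ρ ∧ ρ < 1 ∧ ∀ (S : ℕ) (μW : Measure (GaugeConfig 4 (2 * S + 1) G)),
    μW = (wilsonMeasure r.ρ β : Measure (GaugeConfig 4 (2 * S + 1) G)) →
    ∀ (a : Fin 4 → ZMod (2 * S + 1)) (n : Fin 4 → ℕ), (∀ ν, n ν ≤ 2 * S + 1) →
    ∀ (Q : Set (Site 4 (2 * S + 1))), Q = {x | ∀ ν, (x ν - a ν).val < n ν} →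
    ∀ (K : Set (Edge 4 (2 * S + 1))), K = {ℓ | ℓ.1 ∉ Q} →
    ∀ (i : Fin 4) (c : ℕ), (n i ≤ 2 * S → c + R ≤ n i) →
    ∀ (X : Set (Edge 4 (2 * S + 1))), X = {ℓ | ℓ.1 ∈ Q ∧ (ℓ.1 i - a i - (c : ZMod (2 * S + 1))).val < R} →
    ∀ (Z : Set (Edge 4 (2 * S + 1))),
      Z = {ℓ | ℓ.1 ∈ Q ∧ 3 * R ≤ (ℓ.1 i - a i - (c : ZMod (2 * S + 1)) + (R : ZMod (2 * S + 1))).val} →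
    ∀ f : GaugeConfig 4 (2 * S + 1) G → ℝ, Measurable f → (∃ M : ℝ, ∀ U, |f U| ≤ M) →
    ∫ U, (condExp (cylinderEvents (K ∪ X)) μW (condExp (cylinderEvents (K ∪ Z)) μW f) U
        - condExp (cylinderEvents K) μW f U) ^ 2 ∂μW ≤
      ρ ^ 2 * ∫ U, (f U - condExp (cylinderEvents K) μW f U) ^ 2 ∂μW

/-- (B) `BoxDecoupling r β` — what the bisection consumes: there are `R ≥ 1` and `ρ < 1` such that for every cylinder `Q`
with exterior `K` and every direction `i`:
(ring)     if side `i` is a full ring and `2R ≤ S`, the antipodal `R`-slabs at `b` and `b + S` satisfy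
           `‖P_{K∪Y₁} P_{K∪Y₂} f − P_K f‖₂ ≤ ρ ‖f − P_K f‖₂`;
(corridor) if side `i` is an interval, the part of `Q` below offset `c` (`c ≥ R`) and the part above offset `c + mR` satisfy
           the same bound with `ρ^{⌊m/2⌋}` (decoupling across a corridor of `m` consecutive `R`-slabs). -/
def BoxDecoupling (r : LatticeRep G) (β : ℝ) : Prop :=
  ∃ R : ℕ, 1 ≤ R ∧ ∃ ρ : ℝ, 0 ≤ ρ ∧ ρ < 1 ∧ ∀ (S : ℕ) (μW : Measure (GaugeConfig 4 (2 * S + 1) G)),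
    μW = (wilsonMeasure r.ρ β : Measure (GaugeConfig 4 (2 * S + 1) G)) →
    ∀ (a : Fin 4 → ZMod (2 * S + 1)) (n : Fin 4 → ℕ), (∀ ν, n ν ≤ 2 * S + 1) →
    ∀ (Q : Set (Site 4 (2 * S + 1))), Q = {x | ∀ ν, (x ν - a ν).val < n ν} →
    ∀ (K : Set (Edge 4 (2 * S + 1))), K = {ℓ | ℓ.1 ∉ Q} →
    ∀ (i : Fin 4),
    (n i = 2 * S + 1 → 2 * R ≤ S → ∀ (b : ZMod (2 * S + 1)) (X Z : Set (Edge 4 (2 * S + 1))),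
      X = {ℓ | ℓ.1 ∈ Q ∧ (ℓ.1 i - b).val < R} →
      Z = {ℓ | ℓ.1 ∈ Q ∧ (ℓ.1 i - b - (S : ZMod (2 * S + 1))).val < R} →
      ∀ f : GaugeConfig 4 (2 * S + 1) G → ℝ, Measurable f → (∃ M : ℝ, ∀ U, |f U| ≤ M) →
      ∫ U, (condExp (cylinderEvents (K ∪ X)) μW (condExp (cylinderEvents (K ∪ Z)) μW f) U
          - condExp (cylinderEvents K) μW f U) ^ 2 ∂μW ≤
        ρ ^ 2 * ∫ U, (f U - condExp (cylinderEvents K) μW f U) ^ 2 ∂μW) ∧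
    (n i ≤ 2 * S → ∀ (c m : ℕ), R ≤ c → ∀ (X Z : Set (Edge 4 (2 * S + 1))),
      X = {ℓ | ℓ.1 ∈ Q ∧ (ℓ.1 i - a i).val < c} →
      Z = {ℓ | ℓ.1 ∈ Q ∧ c + m * R ≤ (ℓ.1 i - a i).val} →
      ∀ f : GaugeConfig 4 (2 * S + 1) G → ℝ, Measurable f → (∃ M : ℝ, ∀ U, |f U| ≤ M) →
      ∫ U, (condExp (cylinderEvents (K ∪ X)) μW (condExp (cylinderEvents (K ∪ Z)) μW f) U
          - condExp (cylinderEvents K) μW f U) ^ 2 ∂μW ≤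
        (ρ ^ (m / 2)) ^ 2 * ∫ U, (f U - condExp (cylinderEvents K) μW f U) ^ 2 ∂μW)

/-- `LocalPoincareSmall r β` — per-volume Poincaré for SMALL cylinders, uniformly in the torus and the exterior: for every
`m` there is `C = C(m, G, r, β)` such that for every cylinder `Q` with all sides `≤ m` and every bounded measurable `F`,
`E(F − E[F | links outside Q])² ≤ C · Σ_{ℓ based in Q} ∫∫ (F U − F(U[ℓ ↦ g]))² dν_ℓ^U dμ`. -/
def LocalPoincareSmall (r : LatticeRep G) (β : ℝ) : Prop :=
  ∀ m : ℕ, ∃ C : ℝ, ∀ (S : ℕ) (μW : Measure (GaugeConfig 4 (2 * S + 1) G)),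
    μW = (wilsonMeasure r.ρ β : Measure (GaugeConfig 4 (2 * S + 1) G)) →
    ∀ (a : Fin 4 → ZMod (2 * S + 1)) (n : Fin 4 → ℕ), (∀ ν, n ν ≤ m) → (∀ ν, n ν ≤ 2 * S + 1) →
    ∀ (Q : Set (Site 4 (2 * S + 1))), Q = {x | ∀ ν, (x ν - a ν).val < n ν} →
    ∀ F : GaugeConfig 4 (2 * S + 1) G → ℝ, Measurable F → (∃ M : ℝ, ∀ U, |F U| ≤ M) →
    ∫ U, (F U - condExp (cylinderEvents {ℓ : Edge 4 (2 * S + 1) | ℓ.1 ∉ Q}) μW F U) ^ 2 ∂μW ≤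
      C * ∑ ℓ : Edge 4 (2 * S + 1), Set.indicator {ℓ : Edge 4 (2 * S + 1) | ℓ.1 ∈ Q}
        (fun ℓ => ∫ U, ∫ g, (F U - F (Function.update U ℓ g)) ^ 2
          ∂((haarProbability G).tilted (fun g' => -β * wilsonAction r.ρ (Function.update U ℓ g'))) ∂μW) ℓ

end Vocabulary

/-- `TwoBlockFactorization G` — the sharp two-block (Hilbert-angle) factorisation of the conditional variance, for every
probability measure on a gauge-configuration space of the four-torus: if `K ⊆ D₁`, `K ⊆ D₂` and
`‖P_{D₁} P_{D₂} h − P_K h‖₂ ≤ ρ ‖h − P_K h‖₂` for all bounded measurable `h` (`0 ≤ ρ < 1`), then for all bounded measurable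
`F`: `E(F − P_K F)² ≤ (1 − ρ)⁻² (E(F − P_{D₁} F)² + E(F − P_{D₂} F)²)`. -/
def TwoBlockFactorization (G : Type) [MeasurableSpace G] : Prop :=
  ∀ (S : ℕ) (μ : Measure (GaugeConfig 4 (2 * S + 1) G)) [IsProbabilityMeasure μ]
    (K D₁ D₂ : Set (Edge 4 (2 * S + 1))), K ⊆ D₁ → K ⊆ D₂ → ∀ ρ : ℝ, 0 ≤ ρ → ρ < 1 →
    (∀ h : GaugeConfig 4 (2 * S + 1) G → ℝ, Measurable h → (∃ M : ℝ, ∀ U, |h U| ≤ M) →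
      ∫ U, (condExp (cylinderEvents D₁) μ (condExp (cylinderEvents D₂) μ h) U
          - condExp (cylinderEvents K) μ h U) ^ 2 ∂μ ≤
        ρ ^ 2 * ∫ U, (h U - condExp (cylinderEvents K) μ h U) ^ 2 ∂μ) →
    ∀ F : GaugeConfig 4 (2 * S + 1) G → ℝ, Measurable F → (∃ M : ℝ, ∀ U, |F U| ≤ M) →
    ∫ U, (F U - condExp (cylinderEvents K) μ F U) ^ 2 ∂μ ≤
      (1 / (1 - ρ) ^ 2) * ((∫ U, (F U - condExp (cylinderEvents D₁) μ F U) ^ 2 ∂μ) +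
        ∫ U, (F U - condExp (cylinderEvents D₂) μ F U) ^ 2 ∂μ)

/-- The crux, re-read through `FS`/`UP` (definitional). -/
theorem crux_iff :
    Summit.QuantumFields.YangMills.Theses.FradkinShenkerFlow.SusceptibilityToPoincare ↔
      ∀ (G : Type) [Group G] [TopologicalSpace G] [IsTopologicalGroup G] [CompactSpace G]
        [MeasurableSpace G] [BorelSpace G], IsCompactSimpleLieGroup G →
        ∀ (r : LatticeRep G) (β : ℝ), 0 ≤ β → FS r β → UP r β :=
  Iff.rfl

/-! ### §1 Statements of the seven stubs as named propositions (for the sorry-free composition) -/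

/-- Statement of stub C2 `stub_boxDecoupling_of_hmc`. -/
def BoxDecouplingOfHMC : Prop :=
  ∀ (G : Type) [Group G] [TopologicalSpace G] [IsTopologicalGroup G] [CompactSpace G]
    [MeasurableSpace G] [BorelSpace G] (r : LatticeRep G) (β : ℝ), HMC r β → BoxDecoupling r β

/-- Statement of stub C3 `stub_localPoincare_smallCylinders`. -/
def LocalPoincareSmallHolds : Prop :=
  ∀ (G : Type) [Group G] [TopologicalSpace G] [IsTopologicalGroup G] [CompactSpace G]
    [MeasurableSpace G] [BorelSpace G] (r : LatticeRep G) (β : ℝ), LocalPoincareSmall r β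

/-- Statement of stub C4 `stub_bisection`. -/
def Bisection : Prop :=
  ∀ (G : Type) [Group G] [TopologicalSpace G] [IsTopologicalGroup G] [CompactSpace G]
    [MeasurableSpace G] [BorelSpace G] (r : LatticeRep G) (β : ℝ),
    TwoBlockFactorization G → BoxDecoupling r β → LocalPoincareSmall r β → UP r β

/-- Statement of stub A1 `stub_hmc_of_torusDecorrelation`. -/
def HMCOfTorusDecorrelation : Prop :=
  ∀ (G : Type) [Group G] [TopologicalSpace G] [IsTopologicalGroup G] [CompactSpace G]
    [MeasurableSpace G] [BorelSpace G], IsCompactSimpleLieGroup G →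
    ∀ (r : LatticeRep G) (β : ℝ), 0 ≤ β → FS r β → TorusDecorrelation r β → HMC r β

/-- Statement of stub A2 `stub_torusDecorrelation_of_fs`. -/
def TorusDecorrelationOfFS : Prop :=
  ∀ (G : Type) [Group G] [TopologicalSpace G] [IsTopologicalGroup G] [CompactSpace G]
    [MeasurableSpace G] [BorelSpace G], IsCompactSimpleLieGroup G → SimplyConnectedSpace G →
    ∀ (r : LatticeRep G) (β : ℝ), 0 ≤ β → FS r β → TorusDecorrelation r β

/-- Statement of stub A3 `stub_torusDecorrelation_of_fs_nonSimplyConnected` (scope sentinel). -/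
def TorusDecorrelationOfFSNonSimplyConnected : Prop :=
  ∀ (G : Type) [Group G] [TopologicalSpace G] [IsTopologicalGroup G] [CompactSpace G]
    [MeasurableSpace G] [BorelSpace G], IsCompactSimpleLieGroup G → ¬ SimplyConnectedSpace G →
    ∀ (r : LatticeRep G) (β : ℝ), 0 ≤ β → FS r β → TorusDecorrelation r β

/-! ### §2 The registered stubs (`sorry` only here) -/

/-- `stub_twoBlockFactorization` — **sharp two-block factorisation of the conditional variance** (C1; provable now, size M;
the idea card's first lemma in the ITERABLE form demanded by TRIAGE-r1-2 (m1) / r1-3 (a), whose real-arithmetic core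
`‖g‖² ≤ a₁² + (a₂ + ρ a₁)²/(1 − ρ²)² ≤ (1 − ρ)⁻²(a₁² + a₂²)` the triager checked as `sharp_angle_ineq`).
For EVERY probability measure `μ` on `G^{E}` of the four-torus, link sets `K ⊆ D₁`, `K ⊆ D₂`, and `0 ≤ ρ < 1` with
`‖P_{D₁}P_{D₂}h − P_K h‖₂ ≤ ρ‖h − P_K h‖₂` for all bounded measurable `h` (`P_D = E_μ[·|cylinderEvents D]`): for all bounded
measurable `F`, `‖F − P_K F‖₂² ≤ (1−ρ)⁻² (‖F − P_{D₁}F‖₂² + ‖F − P_{D₂}F‖₂²)`.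
Proof: `g := F − P_K F`, `E_i := P_{D_i}` (orthogonal projections in L², `condExpL2`; `E_i P_K = P_K E_i = P_K` by the tower
property since `cylinderEvents K ≤ cylinderEvents D_i`, `cylinderEvents_mono`), `a_i := ‖g − E_i g‖ = ‖F − E_i F‖`.
`‖E₁g‖² = ⟨E₁g, g − E₂g⟩ + ⟨E₁g, E₁E₂g⟩ ≤ ‖E₁g‖ a₂ + ‖E₁g‖ ‖(E₁E₂ − P_K)(E₂g)‖ ≤ ‖E₁g‖(a₂ + ρ‖E₂g‖)` (apply the hypothesis
to a bounded measurable version of `E₂ g`; `P_K E₂ g = P_K g = 0`); symmetrically `‖E₂g‖ ≤ a₁ + ρ‖E₁g‖` (the hypothesis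
transfers to the adjoint order because `‖(E₁E₂ − P_K)*‖ = ‖E₂E₁ − P_K‖` on L² and bounded measurable functions are dense);
hence `‖E₁g‖ ≤ (a₂ + ρa₁)/(1 − ρ²)` and `‖g‖² = a₁² + ‖E₁g‖² ≤ (1−ρ)⁻²(a₁² + a₂²)` (elementary, TRIAGE-r1-2). -/
theorem stub_twoBlockFactorization :
    ∀ (G : Type) [MeasurableSpace G] (S : ℕ) (μ : Measure (GaugeConfig 4 (2 * S + 1) G)) [IsProbabilityMeasure μ]
      (K D₁ D₂ : Set (Edge 4 (2 * S + 1))), K ⊆ D₁ → K ⊆ D₂ → ∀ ρ : ℝ, 0 ≤ ρ → ρ < 1 →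
      (∀ h : GaugeConfig 4 (2 * S + 1) G → ℝ, Measurable h → (∃ M : ℝ, ∀ U, |h U| ≤ M) →
        ∫ U, (condExp (cylinderEvents D₁) μ (condExp (cylinderEvents D₂) μ h) U
            - condExp (cylinderEvents K) μ h U) ^ 2 ∂μ ≤
          ρ ^ 2 * ∫ U, (h U - condExp (cylinderEvents K) μ h U) ^ 2 ∂μ) →
      ∀ F : GaugeConfig 4 (2 * S + 1) G → ℝ, Measurable F → (∃ M : ℝ, ∀ U, |F U| ≤ M) →
      ∫ U, (F U - condExp (cylinderEvents K) μ F U) ^ 2 ∂μ ≤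
        (1 / (1 - ρ) ^ 2) * ((∫ U, (F U - condExp (cylinderEvents D₁) μ F U) ^ 2 ∂μ) +
          ∫ U, (F U - condExp (cylinderEvents D₂) μ F U) ^ 2 ∂μ) :=
  Summit.QuantumFields.YangMills.Theorems.SusceptibilityToPoincare.stub_twoBlockFactorization

/-- `stub_boxDecoupling_of_hmc` — **Markov submultiplicativity across slabs: (H) ⟹ (B)** (C2; provable now, size M+).
For every compact `G`, lattice representation `r`, real `β`: `HMC r β → BoxDecoupling r β` with the SAME `R, ρ`.
Proof. (i) MONOTONICITY (pure tower algebra): if `X' ⊆ X`, `Z' ⊆ Z` then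
`P_{K∪X'}P_{K∪Z'} − P_K = P_{K∪X'}(P_{K∪X}P_{K∪Z} − P_K)P_{K∪Z'}`, so the bound `ρ` passes to sub-pairs; the RING clause is the
instance `c := (b − a_i).val` of (H) (side `i` a full ring, no offset restriction) because the antipodal slab at `b + S` lies in
the far set of the slab at `b` when `2R ≤ S` (`(S + t + R).val ≥ 3R` for `t < R`).
(ii) MARKOV PROPERTY of the Wilson measure in operator form: the density `e^{−β S_W}` w.r.t. product Haar is a product of
plaquette factors, and a plaquette at `x` in the plane `(i,j)` contains only links based at `x, x+e_i, x+e_j`; hence if every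
path of plaquette-adjacent links from `X` to `Z` inside `Q` meets the slab `Y` (thickness `R ≥ 1` in an interval direction,
the complementary layer being exterior), then `E[f | cylinderEvents (K ∪ X ∪ Y)] = E[f | cylinderEvents (K ∪ Y)]` for `f`
measurable w.r.t. `cylinderEvents (K ∪ Y ∪ Z')` (`Z'` = everything beyond `Y`), by the explicit conditional-density formula
(Bayes' rule for a density w.r.t. a product measure: `E_μ[f | coords in D] = ∫ f·w dHaar^{Dᶜ} / ∫ w dHaar^{Dᶜ}`); in operator
form `P_{K∪X} P_{K∪Z} = P_{K∪X} P_{K∪Y} P_{K∪Z}`.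
(iii) TELESCOPING (TRIAGE-r1-3, exact): for the chain `X₀ = A' — S₁ — S₃ — ⋯ — S_{2j−1} — B' = X_k` (`j = ⌊m/2⌋`, odd slabs
of the corridor), `P_{X₀}P_{X_k} − P_K = Π_l (P_{X_l}P_{X_{l+1}} − P_K)`; the first factor has norm `≤ 1`, every other factor is
`≤ ρ` by (H) + (i) since `S_{2l+1}` and `B'` lie in the far set of `S_{2l−1}` (a full `R`-gap between; `c ≥ R` keeps the top
of the interval side out of the torus-`R`-collar of every slab used, `n_i + R ≤ 2S+1 + c`); so the corridor bound is
`ρ^{⌊m/2⌋}` (`m ≤ 1` or `B' = ∅`: the trivial bound).  All slabs used are full `R`-slabs inside the side (`c' + R ≤ n_i`). -/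
theorem stub_boxDecoupling_of_hmc :
    ∀ (G : Type) [Group G] [TopologicalSpace G] [IsTopologicalGroup G] [CompactSpace G]
      [MeasurableSpace G] [BorelSpace G] (r : LatticeRep G) (β : ℝ),
      (∃ R : ℕ, 1 ≤ R ∧ ∃ ρ : ℝ, 0 ≤ ρ ∧ ρ < 1 ∧ ∀ (S : ℕ) (μW : Measure (GaugeConfig 4 (2 * S + 1) G)),
        μW = (wilsonMeasure r.ρ β : Measure (GaugeConfig 4 (2 * S + 1) G)) →
        ∀ (a : Fin 4 → ZMod (2 * S + 1)) (n : Fin 4 → ℕ), (∀ ν, n ν ≤ 2 * S + 1) →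
        ∀ (Q : Set (Site 4 (2 * S + 1))), Q = {x | ∀ ν, (x ν - a ν).val < n ν} →
        ∀ (K : Set (Edge 4 (2 * S + 1))), K = {ℓ | ℓ.1 ∉ Q} →
        ∀ (i : Fin 4) (c : ℕ), (n i ≤ 2 * S → c + R ≤ n i) →
        ∀ (X : Set (Edge 4 (2 * S + 1))), X = {ℓ | ℓ.1 ∈ Q ∧ (ℓ.1 i - a i - (c : ZMod (2 * S + 1))).val < R} →
        ∀ (Z : Set (Edge 4 (2 * S + 1))),
          Z = {ℓ | ℓ.1 ∈ Q ∧ 3 * R ≤ (ℓ.1 i - a i - (c : ZMod (2 * S + 1)) + (R : ZMod (2 * S + 1))).val} →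
        ∀ f : GaugeConfig 4 (2 * S + 1) G → ℝ, Measurable f → (∃ M : ℝ, ∀ U, |f U| ≤ M) →
        ∫ U, (condExp (cylinderEvents (K ∪ X)) μW (condExp (cylinderEvents (K ∪ Z)) μW f) U
            - condExp (cylinderEvents K) μW f U) ^ 2 ∂μW ≤
          ρ ^ 2 * ∫ U, (f U - condExp (cylinderEvents K) μW f U) ^ 2 ∂μW) →
      ∃ R : ℕ, 1 ≤ R ∧ ∃ ρ : ℝ, 0 ≤ ρ ∧ ρ < 1 ∧ ∀ (S : ℕ) (μW : Measure (GaugeConfig 4 (2 * S + 1) G)),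
        μW = (wilsonMeasure r.ρ β : Measure (GaugeConfig 4 (2 * S + 1) G)) →
        ∀ (a : Fin 4 → ZMod (2 * S + 1)) (n : Fin 4 → ℕ), (∀ ν, n ν ≤ 2 * S + 1) →
        ∀ (Q : Set (Site 4 (2 * S + 1))), Q = {x | ∀ ν, (x ν - a ν).val < n ν} →
        ∀ (K : Set (Edge 4 (2 * S + 1))), K = {ℓ | ℓ.1 ∉ Q} →
        ∀ (i : Fin 4),
        (n i = 2 * S + 1 → 2 * R ≤ S → ∀ (b : ZMod (2 * S + 1)) (X Z : Set (Edge 4 (2 * S + 1))),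
          X = {ℓ | ℓ.1 ∈ Q ∧ (ℓ.1 i - b).val < R} →
          Z = {ℓ | ℓ.1 ∈ Q ∧ (ℓ.1 i - b - (S : ZMod (2 * S + 1))).val < R} →
          ∀ f : GaugeConfig 4 (2 * S + 1) G → ℝ, Measurable f → (∃ M : ℝ, ∀ U, |f U| ≤ M) →
          ∫ U, (condExp (cylinderEvents (K ∪ X)) μW (condExp (cylinderEvents (K ∪ Z)) μW f) U
              - condExp (cylinderEvents K) μW f U) ^ 2 ∂μW ≤
            ρ ^ 2 * ∫ U, (f U - condExp (cylinderEvents K) μW f U) ^ 2 ∂μW) ∧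
        (n i ≤ 2 * S → ∀ (c m : ℕ), R ≤ c → ∀ (X Z : Set (Edge 4 (2 * S + 1))),
          X = {ℓ | ℓ.1 ∈ Q ∧ (ℓ.1 i - a i).val < c} →
          Z = {ℓ | ℓ.1 ∈ Q ∧ c + m * R ≤ (ℓ.1 i - a i).val} →
          ∀ f : GaugeConfig 4 (2 * S + 1) G → ℝ, Measurable f → (∃ M : ℝ, ∀ U, |f U| ≤ M) →
          ∫ U, (condExp (cylinderEvents (K ∪ X)) μW (condExp (cylinderEvents (K ∪ Z)) μW f) U
              - condExp (cylinderEvents K) μW f U) ^ 2 ∂μW ≤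
            (ρ ^ (m / 2)) ^ 2 * ∫ U, (f U - condExp (cylinderEvents K) μW f U) ^ 2 ∂μW) :=
  Summit.QuantumFields.YangMills.Theorems.SusceptibilityToPoincare.stub_boxDecoupling_of_hmc

/-- `stub_localPoincare_smallCylinders` — **per-volume Poincaré for small cylinders, uniformly in the volume and the exterior**
(C3; provable now, size M+).  For every compact `G`, lattice representation `r`, real `β` and size `m` there is
`C = C(m, G, r, β)` (e.g. `4m⁴ · e^{c N |β| m⁴}`) such that for every torus, every cylinder `Q` with all sides `≤ m` and every
bounded measurable `F`: `E(F − E[F | links based outside Q])² ≤ C Σ_{ℓ based in Q} ∫∫ (F U − F(U[ℓ ↦ g]))² dν_ℓ^U dμ`.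
Proof: conditionally on the exterior the `≤ 4m⁴` links based in `Q` have a law with density in `[e^{−a}, e^{a}]`
(`a = O(N|β| m⁴)`) w.r.t. product Haar (the Wilson density is a product of plaquette factors `∈ [e^{−2N|β|}, 1]`;
`wilsonMeasure_eq_tilted_pi`); the conditional variance is `≤` the variance w.r.t. any other centring, so Holley–Stroock
reduces to product Haar, where Efron–Stein (`Literature.Probability.Moments.EfronSteinInequality_holds`) gives
`Var ≤ Σ_ℓ E Var_ℓ ≤ Σ_ℓ ∫∫ (F − F(U[ℓ↦h]))² dHaar`; Haar resampling of one link is dominated by heat-bath resampling at cost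
`e^{12N|β|}` (landed `HaarResample.integral_haar_le_exp_mul_integral_heatBath`, p74627); integrate over the exterior
(the conditional expectation given `cylinderEvents {ℓ | ℓ.1 ∉ Q}` is the explicit partial Haar integral — the same Bayes
formula as in C2).  No `S`-dependence; Disproof §4 ("per-S Poincaré is true") is the case `Q` = the whole small torus. -/
theorem stub_localPoincare_smallCylinders :
    ∀ (G : Type) [Group G] [TopologicalSpace G] [IsTopologicalGroup G] [CompactSpace G]
      [MeasurableSpace G] [BorelSpace G] (r : LatticeRep G) (β : ℝ),
      ∀ m : ℕ, ∃ C : ℝ, ∀ (S : ℕ) (μW : Measure (GaugeConfig 4 (2 * S + 1) G)),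
        μW = (wilsonMeasure r.ρ β : Measure (GaugeConfig 4 (2 * S + 1) G)) →
        ∀ (a : Fin 4 → ZMod (2 * S + 1)) (n : Fin 4 → ℕ), (∀ ν, n ν ≤ m) → (∀ ν, n ν ≤ 2 * S + 1) →
        ∀ (Q : Set (Site 4 (2 * S + 1))), Q = {x | ∀ ν, (x ν - a ν).val < n ν} →
        ∀ F : GaugeConfig 4 (2 * S + 1) G → ℝ, Measurable F → (∃ M : ℝ, ∀ U, |F U| ≤ M) →
        ∫ U, (F U - condExp (cylinderEvents {ℓ : Edge 4 (2 * S + 1) | ℓ.1 ∉ Q}) μW F U) ^ 2 ∂μW ≤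
          C * ∑ ℓ : Edge 4 (2 * S + 1), Set.indicator {ℓ : Edge 4 (2 * S + 1) | ℓ.1 ∈ Q}
            (fun ℓ => ∫ U, ∫ g, (F U - F (Function.update U ℓ g)) ^ 2
              ∂((haarProbability G).tilted (fun g' => -β * wilsonAction r.ρ (Function.update U ℓ g'))) ∂μW) ℓ :=
  Summit.QuantumFields.YangMills.Theorems.SusceptibilityToPoincare.stub_localPoincare_smallCylinders

/-- `stub_bisection` — **Martinelli's bisection in maximal-correlation currency** (C4; provable now, size L; TRIAGE-r1-2 (m1),
r1-3 (a): the recursion that DOES close uniformly).  For every compact `G`, `r`, real `β`: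
two-block factorisation (C1-statement) → `BoxDecoupling r β` → `LocalPoincareSmall r β` → UP(r, β).
Proof sketch.  Let `γ(Q) := sup_F E(F − P_{exterior}F)² / hb_Q(F)` (local Poincaré constant of the cylinder `Q`, integrated
form; `hb_Q` = the heat-bath form restricted to links based in `Q`).  Facts: `γ` of the full torus bounds `Var F / hb(F)`
(`cylinderEvents ∅ = ⊥`, `condExp_bot`); `Q ↦ E(F − P_{Qᶜ}F)²` is monotone; `hb_{Λ₁} + hb_{Λ₂} = hb_Q + hb_{Λ₁∩Λ₂}`.
STEP 1 (open the rings; only for `2R ≤ S`, smaller tori are base cases): for a ring side `i` of `Q` take the antipodal slabs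
`Y₁ = [a_i, a_i+R)`, `Y₂ = [a_i+S, a_i+S+R)`; `Q∖Y₁`, `Q∖Y₂` are cylinders whose side `i` is an interval of length
`2S+1−R`, their union is `Q`; C1 with `D_j = K ∪ links(Y_j)` and the ring clause of (B) give
`γ(Q) ≤ 2(1−ρ)⁻² max γ(Q∖Y_j)`; four directions: factor `(2(1−ρ)⁻²)⁴`.
STEP 2 (bisection of boxes, all sides intervals `≤ 2S`): scales `l_k = l₀ (3/2)^k`; a box with all sides `≤ l_{k+1}` is cut,
in each direction whose side exceeds `l_k` (at most 4 times), across a corridor of `m_k = ⌊√l_k / R⌋` consecutive `R`-slabs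
placed at one of `s_k ≍ √l_k / 8` disjoint positions in the middle third: C1 with `D₁ = K ∪ links(A')`, `D₂ = K ∪ links(B')`
(the corridor clause of (B): `ρ_k = ρ^{⌊m_k/2⌋}`) gives `E(F−P_K F)² ≤ (1−ρ_k)⁻²(γ₁ hb_{Λ₁} + γ₂ hb_{Λ₂})`, and averaging over
the `s_k` positions absorbs the corridor's double-counted form: `γ_{k+1} ≤ [(1−ρ_k)⁻²(1 + 1/s_k)]⁴ γ_k`; corridors lie in
the middle third of the cut side `n ≤ l_{k+1}`, so both children have that side `≤ 2n/3 ≤ l_k` and `c ≥ n/3 ≥ R`.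
`Π_k [(1−ρ^{⌊m_k/2⌋})⁻²(1 + 1/s_k)]⁴ < ∞` (geometric `l_k`).
STEP 3 (base): `γ₀ ≤ C(l₀)` and tori with `2S+1 ≤ max(l₀, 4R)` by `LocalPoincareSmall` (C3).  The final constant depends on
`R, ρ, β, G, r` only; the conclusion is UP verbatim (`Set.indicator univ = id` on the form).
Sources: Martinelli1999 (Saint-Flour XXVII, LNM 1717) Thm 4.3–4.5; Cesi, PTRF 120 (2001) 569 (quasi-factorisation);
MartinelliOlivieri1994. -/
theorem stub_bisection :
    ∀ (G : Type) [Group G] [TopologicalSpace G] [IsTopologicalGroup G] [CompactSpace G]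
      [MeasurableSpace G] [BorelSpace G] (r : LatticeRep G) (β : ℝ),
      (∀ (S : ℕ) (μ : Measure (GaugeConfig 4 (2 * S + 1) G)) [IsProbabilityMeasure μ]
        (K D₁ D₂ : Set (Edge 4 (2 * S + 1))), K ⊆ D₁ → K ⊆ D₂ → ∀ ρ : ℝ, 0 ≤ ρ → ρ < 1 →
        (∀ h : GaugeConfig 4 (2 * S + 1) G → ℝ, Measurable h → (∃ M : ℝ, ∀ U, |h U| ≤ M) →
          ∫ U, (condExp (cylinderEvents D₁) μ (condExp (cylinderEvents D₂) μ h) U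
              - condExp (cylinderEvents K) μ h U) ^ 2 ∂μ ≤
            ρ ^ 2 * ∫ U, (h U - condExp (cylinderEvents K) μ h U) ^ 2 ∂μ) →
        ∀ F : GaugeConfig 4 (2 * S + 1) G → ℝ, Measurable F → (∃ M : ℝ, ∀ U, |F U| ≤ M) →
        ∫ U, (F U - condExp (cylinderEvents K) μ F U) ^ 2 ∂μ ≤
          (1 / (1 - ρ) ^ 2) * ((∫ U, (F U - condExp (cylinderEvents D₁) μ F U) ^ 2 ∂μ) +
            ∫ U, (F U - condExp (cylinderEvents D₂) μ F U) ^ 2 ∂μ)) →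
      (∃ R : ℕ, 1 ≤ R ∧ ∃ ρ : ℝ, 0 ≤ ρ ∧ ρ < 1 ∧ ∀ (S : ℕ) (μW : Measure (GaugeConfig 4 (2 * S + 1) G)),
        μW = (wilsonMeasure r.ρ β : Measure (GaugeConfig 4 (2 * S + 1) G)) →
        ∀ (a : Fin 4 → ZMod (2 * S + 1)) (n : Fin 4 → ℕ), (∀ ν, n ν ≤ 2 * S + 1) →
        ∀ (Q : Set (Site 4 (2 * S + 1))), Q = {x | ∀ ν, (x ν - a ν).val < n ν} →
        ∀ (K : Set (Edge 4 (2 * S + 1))), K = {ℓ | ℓ.1 ∉ Q} →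
        ∀ (i : Fin 4),
        (n i = 2 * S + 1 → 2 * R ≤ S → ∀ (b : ZMod (2 * S + 1)) (X Z : Set (Edge 4 (2 * S + 1))),
          X = {ℓ | ℓ.1 ∈ Q ∧ (ℓ.1 i - b).val < R} →
          Z = {ℓ | ℓ.1 ∈ Q ∧ (ℓ.1 i - b - (S : ZMod (2 * S + 1))).val < R} →
          ∀ f : GaugeConfig 4 (2 * S + 1) G → ℝ, Measurable f → (∃ M : ℝ, ∀ U, |f U| ≤ M) →
          ∫ U, (condExp (cylinderEvents (K ∪ X)) μW (condExp (cylinderEvents (K ∪ Z)) μW f) U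
              - condExp (cylinderEvents K) μW f U) ^ 2 ∂μW ≤
            ρ ^ 2 * ∫ U, (f U - condExp (cylinderEvents K) μW f U) ^ 2 ∂μW) ∧
        (n i ≤ 2 * S → ∀ (c m : ℕ), R ≤ c → ∀ (X Z : Set (Edge 4 (2 * S + 1))),
          X = {ℓ | ℓ.1 ∈ Q ∧ (ℓ.1 i - a i).val < c} →
          Z = {ℓ | ℓ.1 ∈ Q ∧ c + m * R ≤ (ℓ.1 i - a i).val} →
          ∀ f : GaugeConfig 4 (2 * S + 1) G → ℝ, Measurable f → (∃ M : ℝ, ∀ U, |f U| ≤ M) →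
          ∫ U, (condExp (cylinderEvents (K ∪ X)) μW (condExp (cylinderEvents (K ∪ Z)) μW f) U
              - condExp (cylinderEvents K) μW f U) ^ 2 ∂μW ≤
            (ρ ^ (m / 2)) ^ 2 * ∫ U, (f U - condExp (cylinderEvents K) μW f U) ^ 2 ∂μW)) →
      (∀ m : ℕ, ∃ C : ℝ, ∀ (S : ℕ) (μW : Measure (GaugeConfig 4 (2 * S + 1) G)),
        μW = (wilsonMeasure r.ρ β : Measure (GaugeConfig 4 (2 * S + 1) G)) →
        ∀ (a : Fin 4 → ZMod (2 * S + 1)) (n : Fin 4 → ℕ), (∀ ν, n ν ≤ m) → (∀ ν, n ν ≤ 2 * S + 1) →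
        ∀ (Q : Set (Site 4 (2 * S + 1))), Q = {x | ∀ ν, (x ν - a ν).val < n ν} →
        ∀ F : GaugeConfig 4 (2 * S + 1) G → ℝ, Measurable F → (∃ M : ℝ, ∀ U, |F U| ≤ M) →
        ∫ U, (F U - condExp (cylinderEvents {ℓ : Edge 4 (2 * S + 1) | ℓ.1 ∉ Q}) μW F U) ^ 2 ∂μW ≤
          C * ∑ ℓ : Edge 4 (2 * S + 1), Set.indicator {ℓ : Edge 4 (2 * S + 1) | ℓ.1 ∈ Q}
            (fun ℓ => ∫ U, ∫ g, (F U - F (Function.update U ℓ g)) ^ 2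
              ∂((haarProbability G).tilted (fun g' => -β * wilsonAction r.ρ (Function.update U ℓ g'))) ∂μW) ℓ) →
      ∃ C : ℝ, ∀ S : ℕ, ∀ F : GaugeConfig 4 (2 * S + 1) G → ℝ, Measurable F → (∃ M : ℝ, ∀ U, |F U| ≤ M) →
        variance F (wilsonMeasure r.ρ β : Measure (GaugeConfig 4 (2 * S + 1) G)) ≤
          C * ∑ ℓ : Edge 4 (2 * S + 1), ∫ U, ∫ g, (F U - F (Function.update U ℓ g)) ^ 2
            ∂((haarProbability G).tilted (fun g' => -β * wilsonAction r.ρ (Function.update U ℓ g')))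
            ∂(wilsonMeasure r.ρ β : Measure (GaugeConfig 4 (2 * S + 1) G)) :=
  Summit.QuantumFields.YangMills.Theorems.SusceptibilityToPoincare.stub_bisection

/-- `stub_hmc_of_torusDecorrelation` — **bulk one-scale decorrelation is robust under freezing an exterior: FS ∧ (T) ⟹ (H)**
(A1; size L–XL; plausible, NOT known).  For every compact simple `G` (any `π₁`), `r`, `β ≥ 0`: if FS holds and the torus measures have the
one-scale slab decorrelation (T) at some `(R, ρ)`, then every cylinder with every exterior has it at some `(R', ρ')` (far set
and slabs inside the cylinder, conditioning on all links outside; fibrewise in the boundary data).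
Why plausibly true: (T) makes the bulk massive at scale `R` (transfer-matrix gap via reflection positivity); a frozen exterior
acts on the interior only through the plaquettes straddling `∂Q`, i.e. as bounded boundary "staple fields" on the first layer;
in a massive bulk their influence decays `e^{−m·depth}` and, conditionally on the exterior, the boundary layer is in a single
(explicitly pinned) state, so no statistic of a slab is shared with its far set; for `π₁(G) = 0` a box with frozen exterior
has a connected configuration space (no sector).  At strong coupling both (T) and (H) follow from the convergent cluster
expansion with `ρ = O(β)` (consistency: tree `LatticeGaugeDobrushinPoincare`, fact `shen_zhu_zhu`).
WHY IT MIGHT FAIL (TRIAGE-r1-2 (m2), the line's specific risk, isolated here on purpose): (H) is a sup over ALL boundary data;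
an exterior tuned to a first-order transition of the boundary FILM (wall-induced coexistence of two film states along a face,
the boundary analogue of the Fradkin–Shenker first-order line arXiv:0911.1721) would make a film observable in a slab and one
in its far set share the bit "which film state", ρ → 1, with (T) intact — then local Poincaré constants with frozen exteriors
blow up (while the annealed UP may survive), i.e. every frozen-exterior bisection dies, not the crux.  Cheapest falsifier:
kit, SU(2), β ∈ {2.3, 2.5}, box 8×L³ inside tori L ≤ 12 with the exterior frozen to a uniform staple field of strength s on
the two large faces: scan s for hysteresis / double-peaked histograms of the boundary-layer plaquette (film coexistence). -/
theorem stub_hmc_of_torusDecorrelation :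
    ∀ (G : Type) [Group G] [TopologicalSpace G] [IsTopologicalGroup G] [CompactSpace G]
      [MeasurableSpace G] [BorelSpace G], IsCompactSimpleLieGroup G →
      ∀ (r : LatticeRep G) (β : ℝ), 0 ≤ β →
      (∀ A B : YMSpecies G, ∃ χ : ℝ, ∀ S : ℕ, ∑ x ∈ Literature.Probability.LatticeModels.box 4 S,
        |covariance (fun U => A.F (Literature.MathematicalPhysics.QuantumLattice.torusLift (2 * S + 1) U))
          (fun U => B.F (Literature.MathematicalPhysics.QuantumLattice.configShift (-x)
          (Literature.MathematicalPhysics.QuantumLattice.torusLift (2 * S + 1) U)))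
          (wilsonMeasure r.ρ β : Measure (GaugeConfig 4 (2 * S + 1) G))| ≤ χ) →
      (∃ R : ℕ, 1 ≤ R ∧ ∃ ρ : ℝ, 0 ≤ ρ ∧ ρ < 1 ∧ ∀ (S : ℕ) (μW : Measure (GaugeConfig 4 (2 * S + 1) G)),
        μW = (wilsonMeasure r.ρ β : Measure (GaugeConfig 4 (2 * S + 1) G)) →
        ∀ (i : Fin 4) (b : ZMod (2 * S + 1)),
        ∀ f : GaugeConfig 4 (2 * S + 1) G → ℝ, Measurable f → (∃ M : ℝ, ∀ U, |f U| ≤ M) →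
        ∫ U, (condExp (cylinderEvents {ℓ : Edge 4 (2 * S + 1) | (ℓ.1 i - b).val < R}) μW
            (condExp (cylinderEvents {ℓ : Edge 4 (2 * S + 1) | 3 * R ≤ (ℓ.1 i - b + (R : ZMod (2 * S + 1))).val}) μW f) U
            - ∫ V, f V ∂μW) ^ 2 ∂μW ≤
          ρ ^ 2 * ∫ U, (f U - ∫ V, f V ∂μW) ^ 2 ∂μW) →
      ∃ R : ℕ, 1 ≤ R ∧ ∃ ρ : ℝ, 0 ≤ ρ ∧ ρ < 1 ∧ ∀ (S : ℕ) (μW : Measure (GaugeConfig 4 (2 * S + 1) G)),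
        μW = (wilsonMeasure r.ρ β : Measure (GaugeConfig 4 (2 * S + 1) G)) →
        ∀ (a : Fin 4 → ZMod (2 * S + 1)) (n : Fin 4 → ℕ), (∀ ν, n ν ≤ 2 * S + 1) →
        ∀ (Q : Set (Site 4 (2 * S + 1))), Q = {x | ∀ ν, (x ν - a ν).val < n ν} →
        ∀ (K : Set (Edge 4 (2 * S + 1))), K = {ℓ | ℓ.1 ∉ Q} →
        ∀ (i : Fin 4) (c : ℕ), (n i ≤ 2 * S → c + R ≤ n i) →
        ∀ (X : Set (Edge 4 (2 * S + 1))), X = {ℓ | ℓ.1 ∈ Q ∧ (ℓ.1 i - a i - (c : ZMod (2 * S + 1))).val < R} →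
        ∀ (Z : Set (Edge 4 (2 * S + 1))),
          Z = {ℓ | ℓ.1 ∈ Q ∧ 3 * R ≤ (ℓ.1 i - a i - (c : ZMod (2 * S + 1)) + (R : ZMod (2 * S + 1))).val} →
        ∀ f : GaugeConfig 4 (2 * S + 1) G → ℝ, Measurable f → (∃ M : ℝ, ∀ U, |f U| ≤ M) →
        ∫ U, (condExp (cylinderEvents (K ∪ X)) μW (condExp (cylinderEvents (K ∪ Z)) μW f) U
            - condExp (cylinderEvents K) μW f U) ^ 2 ∂μW ≤
          ρ ^ 2 * ∫ U, (f U - condExp (cylinderEvents K) μW f U) ^ 2 ∂μW := by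
  sorry

/-- `stub_torusDecorrelation_of_fs` — **THE INFRARED STUB: finite susceptibility ⟹ one-scale slab decorrelation on the torus,
simply-connected case** (A2; OPEN, XL — the hardest stub; the lead's held stub of this line).  For compact simple `G` with
`π₁(G) = 0`, faithful unitary `r`, `β ≥ 0`: FS(r, β) ⟹ (T): ∃ `R ≥ 1`, `ρ < 1`, on every torus and for every direction and
position, `‖E[E[f | far] | slab] − E f‖₂ ≤ ρ ‖f − E f‖₂` for all bounded measurable `f`.
What it says (reflection-positivity dictionary, OsterwalderSeilerAnnPhys1978): for time slabs, `Cov(f(slab), g(far))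
≤ ‖f̂Ω‖‖ĝΩ‖ λ₁(S)^R` with `‖f̂Ω‖² = ⟨θf̄·f⟩ ≤ Var f`, so (T) at scale `R` is `λ₁(S)^R ≤ ρ` — a transfer-matrix gap
`m_S ≥ |log ρ|/R` UNIFORM in the spatial volume, at ONE scale, with no rate claimed: the weakest static form of clustering.
So A2 = "sharpness for gauge theories": summable gauge-invariant correlations ⟹ a volume-uniform one-scale gap.  Elitzur as a
resource (card (c), `wilsonMeasure_map_gaugeTransform_holds`): slab and far set touch disjoint sites, so only their
gauge-INVARIANT contents correlate (`Cov(u, v) = Cov(P_inv u, v)`) — exactly the algebra FS speaks about; and UP makes a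
support-quadratic structure-factor bound NECESSARY (card Transfer (5)), which is what bounds the LINEAR canonical correlations.
Why it might fail: FS (ℓ¹-summability of connected correlations of local singlets) does not imply a uniform gap abstractly
(spectral weight `ε(S)` at `λ ↑ 1` with `ε/(1−λ)` bounded; TRIAGE "abstract-implication barrier"), and FS is infrared-BLIND
for simple `G` (`Δ(tr F²) = d` ⟹ singlet correlators summable even in a massless non-abelian phase, TRIAGE S2): the d = 5
twin of A2 is FALSE under `Literature.Barriers.QuantumFields.NonabelianCoulombPhaseD5` (FS₅ true, HMC₅ false), so a proof
must use a genuinely four-dimensional input (asymptotic freedom / absence of an infrared-transparent phase) — none is in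
print; this stub is where the crux meets the summit's difficulty (it is NOT an upgrader).  `π₁(G) = 0` is load-bearing: for
SO(3) the 't Hooft twist through a plane inside the slab is readable in the far set (ρ = 1; Disproof §2, sentinel A3).
Sources: Simon1980, AizenmanBarskyFernandez1987, DuminilCopinTassionCMP2016 (sharpness templates, no gauge analogue);
MartinelliOlivieri1994; OsterwalderSeilerAnnPhys1978; arXiv:1803.01950 (Chatterjee, Problem 5.1); Bradley, J. Theor. Probab. 5
(1992) 355 (ρ*-mixing vs spectral density); DingSongSun2022 (no gauge analogue). -/
theorem stub_torusDecorrelation_of_fs :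
    ∀ (G : Type) [Group G] [TopologicalSpace G] [IsTopologicalGroup G] [CompactSpace G]
      [MeasurableSpace G] [BorelSpace G], IsCompactSimpleLieGroup G → SimplyConnectedSpace G →
      ∀ (r : LatticeRep G) (β : ℝ), 0 ≤ β →
      (∀ A B : YMSpecies G, ∃ χ : ℝ, ∀ S : ℕ, ∑ x ∈ Literature.Probability.LatticeModels.box 4 S,
        |covariance (fun U => A.F (Literature.MathematicalPhysics.QuantumLattice.torusLift (2 * S + 1) U))
          (fun U => B.F (Literature.MathematicalPhysics.QuantumLattice.configShift (-x)
          (Literature.MathematicalPhysics.QuantumLattice.torusLift (2 * S + 1) U)))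
          (wilsonMeasure r.ρ β : Measure (GaugeConfig 4 (2 * S + 1) G))| ≤ χ) →
      ∃ R : ℕ, 1 ≤ R ∧ ∃ ρ : ℝ, 0 ≤ ρ ∧ ρ < 1 ∧ ∀ (S : ℕ) (μW : Measure (GaugeConfig 4 (2 * S + 1) G)),
        μW = (wilsonMeasure r.ρ β : Measure (GaugeConfig 4 (2 * S + 1) G)) →
        ∀ (i : Fin 4) (b : ZMod (2 * S + 1)),
        ∀ f : GaugeConfig 4 (2 * S + 1) G → ℝ, Measurable f → (∃ M : ℝ, ∀ U, |f U| ≤ M) →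
        ∫ U, (condExp (cylinderEvents {ℓ : Edge 4 (2 * S + 1) | (ℓ.1 i - b).val < R}) μW
            (condExp (cylinderEvents {ℓ : Edge 4 (2 * S + 1) | 3 * R ≤ (ℓ.1 i - b + (R : ZMod (2 * S + 1))).val}) μW f) U
            - ∫ V, f V ∂μW) ^ 2 ∂μW ≤
          ρ ^ 2 * ∫ U, (f U - ∫ V, f V ∂μW) ^ 2 ∂μW := by
  sorry

/-- `stub_torusDecorrelation_of_fs_nonSimplyConnected` — **scope sentinel: the same implication for `π₁(G) ≠ 0`** (A3;
SUSPECTED FALSE at weak coupling, NOT to be staffed).  For compact simple `G` that is NOT simply connected (SO(3), PSU(N), …)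
the 't Hooft magnetic twist `w_{jk} ∈ H²(T⁴; π₁(G))` through a coordinate plane `(j,k) ∌ i` is a gauge-invariant function of
the links of ANY slab transverse to `i` that contains a full `(j,k)` 2-torus, and equally of the links of its far set
(Disproof §2: exact conservation / Stokes); if the twist sectors keep mass in `[δ, 1−δ]` ("light magnetic fluxes", expected
for confined SO(3)₄, de Forcrand–Jahn hep-lat/0211004) the shared label gives ρ = 1 and (T) fails while FS is expected to
hold — the line's version of `Disproof.susceptibilityToPoincare_false_of_twistSectorInputs` (killed modulo the same
`H = TwistSectorInputs`, through A1 and C1–C4).  Registered so that the composition covers the crux AS TYPED (all compact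
simple `G`); a refutation BY NAME re-scopes the crux to `SimplyConnectedSpace G` and leaves every other stub verbatim. -/
theorem stub_torusDecorrelation_of_fs_nonSimplyConnected :
    ∀ (G : Type) [Group G] [TopologicalSpace G] [IsTopologicalGroup G] [CompactSpace G]
      [MeasurableSpace G] [BorelSpace G], IsCompactSimpleLieGroup G → ¬ SimplyConnectedSpace G →
      ∀ (r : LatticeRep G) (β : ℝ), 0 ≤ β →
      (∀ A B : YMSpecies G, ∃ χ : ℝ, ∀ S : ℕ, ∑ x ∈ Literature.Probability.LatticeModels.box 4 S,
        |covariance (fun U => A.F (Literature.MathematicalPhysics.QuantumLattice.torusLift (2 * S + 1) U))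
          (fun U => B.F (Literature.MathematicalPhysics.QuantumLattice.configShift (-x)
          (Literature.MathematicalPhysics.QuantumLattice.torusLift (2 * S + 1) U)))
          (wilsonMeasure r.ρ β : Measure (GaugeConfig 4 (2 * S + 1) G))| ≤ χ) →
      ∃ R : ℕ, 1 ≤ R ∧ ∃ ρ : ℝ, 0 ≤ ρ ∧ ρ < 1 ∧ ∀ (S : ℕ) (μW : Measure (GaugeConfig 4 (2 * S + 1) G)),
        μW = (wilsonMeasure r.ρ β : Measure (GaugeConfig 4 (2 * S + 1) G)) →
        ∀ (i : Fin 4) (b : ZMod (2 * S + 1)),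
        ∀ f : GaugeConfig 4 (2 * S + 1) G → ℝ, Measurable f → (∃ M : ℝ, ∀ U, |f U| ≤ M) →
        ∫ U, (condExp (cylinderEvents {ℓ : Edge 4 (2 * S + 1) | (ℓ.1 i - b).val < R}) μW
            (condExp (cylinderEvents {ℓ : Edge 4 (2 * S + 1) | 3 * R ≤ (ℓ.1 i - b + (R : ZMod (2 * S + 1))).val}) μW f) U
            - ∫ V, f V ∂μW) ^ 2 ∂μW ≤
          ρ ^ 2 * ∫ U, (f U - ∫ V, f V ∂μW) ^ 2 ∂μW := by
  sorry

/-! ### §3 The kernel-checked composition (sorry-free) -/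

/-- **(H) ⟹ UP for EVERY compact `G` and real `β`** (the provable half of the card, `up_of_hmc`), from the statements of
C1–C4: BoxDecoupling by C2, then the bisection C4 fed with the two-block factorisation C1 and the small-cylinder base C3. -/
theorem up_of_hmc_of (h1 : ∀ (G : Type) [MeasurableSpace G], TwoBlockFactorization G) (h2 : BoxDecouplingOfHMC)
    (h3 : LocalPoincareSmallHolds) (h4 : Bisection) :
    ∀ (G : Type) [Group G] [TopologicalSpace G] [IsTopologicalGroup G] [CompactSpace G]
      [MeasurableSpace G] [BorelSpace G] (r : LatticeRep G) (β : ℝ), HMC r β → UP r β :=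
  fun G _ _ _ _ _ _ r β hH => h4 G r β (h1 G) (h2 G r β hH) (h3 G r β)

/-- **Composition** (sorry-free, standard axioms): the seven stub STATEMENTS imply the crux in its unfolded form —
(T) by cases on `π₁(G) = 0` (A2/A3), (H) by A1, UP by `up_of_hmc_of`. -/
theorem composition (h1 : ∀ (G : Type) [MeasurableSpace G], TwoBlockFactorization G) (h2 : BoxDecouplingOfHMC)
    (h3 : LocalPoincareSmallHolds) (h4 : Bisection) (h5 : HMCOfTorusDecorrelation) (h6 : TorusDecorrelationOfFS)
    (h7 : TorusDecorrelationOfFSNonSimplyConnected) :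
    ∀ (G : Type) [Group G] [TopologicalSpace G] [IsTopologicalGroup G] [CompactSpace G]
      [MeasurableSpace G] [BorelSpace G], IsCompactSimpleLieGroup G →
      ∀ (r : LatticeRep G) (β : ℝ), 0 ≤ β → FS r β → UP r β := by
  intro G _ _ _ _ _ _ hG r β hβ hFS
  have hT : TorusDecorrelation r β := by
    by_cases hsc : SimplyConnectedSpace G
    · exact h6 G hG hsc r β hβ hFS
    · exact h7 G hG hsc r β hβ hFS
  exact up_of_hmc_of h1 h2 h3 h4 G r β (h5 G hG r β hβ hFS hT)

/-- **The skeleton theorem**: the crux BY NAME from the seven registered stubs (its only non-whitelisted axiom is the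
`sorryAx` of the stubs; `composition` is the sorry-free logic). -/
theorem SusceptibilityToPoincare_of :
    Summit.QuantumFields.YangMills.Theses.FradkinShenkerFlow.SusceptibilityToPoincare :=
  crux_iff.2 (composition stub_twoBlockFactorization stub_boxDecoupling_of_hmc
    stub_localPoincare_smallCylinders stub_bisection stub_hmc_of_torusDecorrelation
    stub_torusDecorrelation_of_fs stub_torusDecorrelation_of_fs_nonSimplyConnected)

end

end Summit.QuantumFields.YangMills.Cruxes.SusceptibilityToPoincare.MaxcorrHalving
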